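import Summits.CriticalPhenomena.PercolationContinuityZ3.Theorems.SahiBoxTP2WeakLimits
import Summits.CriticalPhenomena.PercolationContinuityZ3.Theorems.SahiIsingThreeSites
import Summits.CriticalPhenomena.PercolationContinuityZ3.Theorems.SahiIsingFieldBoxTP2
import Mathlib.Topology.Metrizable.Basic

/-!
# Box-TP₂ is closed under weak convergence on spin spaces; weak limits of Ising measures

Support file of the Sahi cell (`prim-sahi`, typer seat, generation 14; `--supports stmt-CriticalPhenomena-4575`).
Theorems only (no definitions, no named facts, no sorries).  Companion of `SahiBoxTP2WeakLimits.lean`.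

Generation 13 proved that box-TP₂ on `{−1,+1}^ι` is closed under convergence on LOCAL events along a sequence
(`isBoxTP2_of_tendsto_local`) and deduced that the Ising states `μ^±_{β,h}`, `μ^∅_{β,h}` and every tail-trivial
Gibbs state are box-TP₂.  This file gives the form in Mathlib's weak topology on `ProbabilityMeasure` /
`FiniteMeasure`, for arbitrary filters (nets), on any countable product of a countable discrete ordered space
with extreme elements:

* `isBoxTP2_of_tendsto_finiteMeasure_discretePi` / `…_probabilityMeasure_discretePi` — `ι → X`, `ι` countable,
  `X` a countable discrete lattice with least/greatest elements `bot`, `top` (`{−1,+1}`, `Bool`, `Fin (q+1)`, …):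
  the outer boxes are the clopen face boxes `[J_m.piecewise a bot, J_m.piecewise b top]` over an exhaustion
  `J_m ↑ ι`, to which the abstract portmanteau theorem `IsBoxTP2.of_tendsto_finiteMeasure` applies verbatim;
* `isBoxTP2_of_tendsto_probabilityMeasure_spinConfig` (`X = ℤˣ`), `…_bool` (`X = Bool`);
* Ising: `isBoxTP2_of_tendsto_probabilityMeasure_isingMeasure` / `…_fieldIsingMeasure` — every weak limit
  (along any filter) of finite-volume Ising Gibbs measures with arbitrary volumes, boundary conditions and
  (site-dependent) fields, `β ≥ 0`, is box-TP₂; hence (`ι` countably infinite) FKG for all measurable monotone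
  functionals (`integral_mul_integral_le_of_tendsto_isingMeasure`), Sahi positivity of every order given `C_n`
  (`msahiE_nonneg_of_tendsto_isingMeasure_of_sahiConjecture`) and, unconditionally, Sahi's Theorem 2 with two
  free local slots (`msahiE_nonneg_plusSpins_offTwo_of_tendsto_isingMeasure`) and positivity of every order for
  functions of three spins (`msahiE_threeSites_nonneg_of_tendsto_isingMeasure`).

No sorries, no new axioms.
-/

noncomputable section

namespace Summit.CriticalPhenomena.PercolationContinuityZ3.Theorems.SahiBoxTP2

open MeasureTheory Set Filter Topology Function Literature.Combinatorics.Sahi2008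
open Literature.Probability.LatticeModels
open scoped ENNReal

/-! ### Face boxes with general padding -/

section FaceBoxes

variable {ι X : Type*} [DecidableEq ι] [Preorder X] (bot top : X) (hbot : ∀ x, bot ≤ x) (htop : ∀ x, x ≤ top)
include hbot htop

/-- Membership in the `J`-face box `[J.piecewise a bot, J.piecewise b top]` only constrains the coordinates in `J`.
[folklore] -/
theorem mem_Icc_piecewise_pad_iff (J : Finset ι) (a b σ : ι → X) :
    σ ∈ Icc (J.piecewise a (fun _ => bot)) (J.piecewise b (fun _ => top)) ↔ ∀ v ∈ J, a v ≤ σ v ∧ σ v ≤ b v := by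
  simp only [mem_Icc, Pi.le_def]
  constructor
  · rintro ⟨h1, h2⟩ v hv
    exact ⟨by simpa only [Finset.piecewise_eq_of_mem _ _ _ hv] using h1 v,
      by simpa only [Finset.piecewise_eq_of_mem _ _ _ hv] using h2 v⟩
  · intro h
    refine ⟨fun v => ?_, fun v => ?_⟩
    · by_cases hv : v ∈ J
      · rw [Finset.piecewise_eq_of_mem _ _ _ hv]; exact (h v hv).1
      · rw [Finset.piecewise_eq_of_notMem _ _ _ hv]; exact hbot _
    · by_cases hv : v ∈ J
      · rw [Finset.piecewise_eq_of_mem _ _ _ hv]; exact (h v hv).2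
      · rw [Finset.piecewise_eq_of_notMem _ _ _ hv]; exact htop _

/-- The `J`-face box as a finite intersection of one-coordinate conditions. [folklore] -/
theorem Icc_piecewise_pad_eq_biInter (J : Finset ι) (a b : ι → X) :
    Icc (J.piecewise a (fun _ => bot)) (J.piecewise b (fun _ => top)) =
      ⋂ v ∈ J, (fun σ : ι → X => σ v) ⁻¹' Icc (a v) (b v) := by
  ext σ
  rw [mem_Icc_piecewise_pad_iff bot top hbot htop, mem_iInter₂]
  rfl

/-- A box lies in each of its face boxes. [folklore] -/
theorem Icc_subset_Icc_piecewise_pad (J : Finset ι) (a b : ι → X) :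
    Icc a b ⊆ Icc (J.piecewise a (fun _ => bot)) (J.piecewise b (fun _ => top)) := fun σ hσ =>
  (mem_Icc_piecewise_pad_iff bot top hbot htop J a b σ).2 fun v _ => ⟨hσ.1 v, hσ.2 v⟩

/-- Along an increasing sequence of windows the face boxes decrease. [folklore] -/
theorem antitone_Icc_piecewise_pad {J : ℕ → Finset ι} (hJ : Monotone J) (a b : ι → X) :
    Antitone fun m => Icc ((J m).piecewise a (fun _ => bot)) ((J m).piecewise b (fun _ => top)) := by
  intro m m' hmm' σ hσ
  rw [mem_Icc_piecewise_pad_iff bot top hbot htop] at hσ ⊢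
  exact fun v hv => hσ v (hJ hmm' hv)

/-- Along an exhausting sequence of windows the face boxes decrease to the box. [folklore] -/
theorem iInter_Icc_piecewise_pad {J : ℕ → Finset ι} (hJ : ∀ v, ∃ m, v ∈ J m) (a b : ι → X) :
    ⋂ m, Icc ((J m).piecewise a (fun _ => bot)) ((J m).piecewise b (fun _ => top)) = Icc a b := by
  refine Subset.antisymm (fun σ hσ => ?_)
    (subset_iInter fun m => Icc_subset_Icc_piecewise_pad bot top hbot htop (J m) a b)
  rw [mem_iInter] at hσ
  refine ⟨fun v => ?_, fun v => ?_⟩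
  · obtain ⟨m, hm⟩ := hJ v
    exact (((mem_Icc_piecewise_pad_iff bot top hbot htop _ _ _ _).1 (hσ m)) v hm).1
  · obtain ⟨m, hm⟩ := hJ v
    exact (((mem_Icc_piecewise_pad_iff bot top hbot htop _ _ _ _).1 (hσ m)) v hm).2

/-- In any product of discrete spaces the face box over a finite window is open (a cylinder set). [folklore] -/
theorem isOpen_Icc_piecewise_pad [TopologicalSpace X] [DiscreteTopology X] (J : Finset ι) (a b : ι → X) :
    IsOpen (Icc (J.piecewise a (fun _ => bot)) (J.piecewise b (fun _ => top))) := by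
  rw [Icc_piecewise_pad_eq_biInter bot top hbot htop]
  exact isOpen_biInter_finset fun v _ => (isOpen_discrete _).preimage (continuous_apply v)

end FaceBoxes

/-! ### Countable products of a countable discrete ordered space -/

section DiscretePi

variable {ι X κ : Type*} [Countable ι] [Lattice X] [TopologicalSpace X] [DiscreteTopology X]
  [MeasurableSpace X] [OpensMeasurableSpace X] [Countable X] {L : Filter κ} [NeBot L]

/-- **Box-TP₂ is closed under weak convergence of finite measures on `ι → X`**, `ι` countable, `X` a countable
discrete lattice with least and greatest elements `bot`, `top` (e.g. `{−1,+1}`, `Bool`, `Fin (q+1)`), along any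
filter.  (The abstract portmanteau theorem with the clopen face boxes over an exhaustion of `ι` as outer boxes.)
[this work] -/
theorem isBoxTP2_of_tendsto_finiteMeasure_discretePi (bot top : X) (hbot : ∀ x, bot ≤ x) (htop : ∀ x, x ≤ top)
    {μs : κ → FiniteMeasure (ι → X)} {μ : FiniteMeasure (ι → X)} (hconv : Tendsto μs L (𝓝 μ))
    (hbox : ∀ᶠ k in L, IsBoxTP2 (μs k : Measure (ι → X))) : IsBoxTP2 (μ : Measure (ι → X)) := by
  classical
  obtain ⟨J, hJm, hJ⟩ := exists_finset_exhaustion (ι := ι)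
  haveI : OrderClosedTopology X := ⟨isClosed_discrete _⟩
  haveI : HasOuterApproxClosed (ι → X) := by
    letI : PseudoMetricSpace (ι → X) := TopologicalSpace.pseudoMetrizableSpacePseudoMetric _
    infer_instance
  refine IsBoxTP2.of_tendsto_finiteMeasure hconv hbox (fun m a => (J m).piecewise a (fun _ => bot))
    (fun m b => (J m).piecewise b (fun _ => top))
    (fun m a a' => piecewise_inf (J m) a a' _) (fun m a a' => piecewise_sup (J m) a a' _)
    (fun m b b' => piecewise_inf (J m) b b' _) (fun m b b' => piecewise_sup (J m) b b' _)
    (fun m a b => ?_) (fun a b => ?_)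
  · rw [(isOpen_Icc_piecewise_pad bot top hbot htop (J m) a b).interior_eq]
    exact Icc_subset_Icc_piecewise_pad bot top hbot htop (J m) a b
  · have := tendsto_measure_iInter_atTop (μ := (μ : Measure (ι → X)))
      (fun m => (isClosed_Icc (a := (J m).piecewise a (fun _ => bot))
        (b := (J m).piecewise b (fun _ => top))).measurableSet.nullMeasurableSet)
      (antitone_Icc_piecewise_pad bot top hbot htop hJm a b) ⟨0, measure_ne_top _ _⟩
    rw [iInter_Icc_piecewise_pad bot top hbot htop hJ] at this
    exact this

/-- Probability-measure form of `isBoxTP2_of_tendsto_finiteMeasure_discretePi`. [this work] -/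
theorem isBoxTP2_of_tendsto_probabilityMeasure_discretePi (bot top : X) (hbot : ∀ x, bot ≤ x)
    (htop : ∀ x, x ≤ top) {μs : κ → ProbabilityMeasure (ι → X)} {μ : ProbabilityMeasure (ι → X)}
    (hconv : Tendsto μs L (𝓝 μ)) (hbox : ∀ᶠ k in L, IsBoxTP2 (μs k : Measure (ι → X))) :
    IsBoxTP2 (μ : Measure (ι → X)) :=
  isBoxTP2_of_tendsto_finiteMeasure_discretePi bot top hbot htop
    ((ProbabilityMeasure.tendsto_nhds_iff_toFiniteMeasure_tendsto_nhds L).mp hconv)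
    (hbox.mono fun i h => by
      simpa only [Function.comp_apply, ProbabilityMeasure.toMeasure_comp_toFiniteMeasure_eq_toMeasure]
        using h)

end DiscretePi

/-! ### Spin configurations `{−1,+1}^ι` and `{0,1}^ι` -/

section Spins

variable {ι κ : Type*} [Countable ι] {L : Filter κ} [NeBot L]

/-- **Box-TP₂ is closed under weak convergence of probability measures on `{−1,+1}^ι`** (`ι` countable, any
filter). [this work] -/
theorem isBoxTP2_of_tendsto_probabilityMeasure_spinConfig {μs : κ → ProbabilityMeasure (ι → ℤˣ)}
    {μ : ProbabilityMeasure (ι → ℤˣ)} (hconv : Tendsto μs L (𝓝 μ))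
    (hbox : ∀ᶠ k in L, IsBoxTP2 (μs k : Measure (ι → ℤˣ))) : IsBoxTP2 (μ : Measure (ι → ℤˣ)) :=
  isBoxTP2_of_tendsto_probabilityMeasure_discretePi (-1) 1 neg_one_le_intUnits intUnits_le_one hconv hbox

/-- **Box-TP₂ is closed under weak convergence of finite measures on `{−1,+1}^ι`.** [this work] -/
theorem isBoxTP2_of_tendsto_finiteMeasure_spinConfig {μs : κ → FiniteMeasure (ι → ℤˣ)}
    {μ : FiniteMeasure (ι → ℤˣ)} (hconv : Tendsto μs L (𝓝 μ))
    (hbox : ∀ᶠ k in L, IsBoxTP2 (μs k : Measure (ι → ℤˣ))) : IsBoxTP2 (μ : Measure (ι → ℤˣ)) :=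
  isBoxTP2_of_tendsto_finiteMeasure_discretePi (-1) 1 neg_one_le_intUnits intUnits_le_one hconv hbox

/-- **Box-TP₂ is closed under weak convergence of probability measures on `{0,1}^ι`** (laws with FKG
cylinders, `SahiBoxTP2BooleanSpinsCountable.lean`). [this work] -/
theorem isBoxTP2_of_tendsto_probabilityMeasure_bool {μs : κ → ProbabilityMeasure (ι → Bool)}
    {μ : ProbabilityMeasure (ι → Bool)} (hconv : Tendsto μs L (𝓝 μ))
    (hbox : ∀ᶠ k in L, IsBoxTP2 (μs k : Measure (ι → Bool))) : IsBoxTP2 (μ : Measure (ι → Bool)) :=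
  isBoxTP2_of_tendsto_probabilityMeasure_discretePi false true Bool.false_le Bool.le_true hconv hbox

end Spins

/-! ### Weak limits of finite-volume Ising measures -/

section Ising

variable {V κ : Type*} [Countable V] (G : SimpleGraph V) [DecidableEq V] [G.LocallyFinite]
  {L : Filter κ} [NeBot L]

/-- **Every weak limit of finite-volume Ising Gibbs measures is box-TP₂** — arbitrary volumes `Λ_k`, boundary
conditions `bc_k`, common `β ≥ 0` and field `h`, along any filter (Mathlib's weak topology on
`ProbabilityMeasure (V → ℤˣ)`). [this work] -/
theorem isBoxTP2_of_tendsto_probabilityMeasure_isingMeasure {β : ℝ} (hβ : 0 ≤ β) (h : ℝ)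
    (Λs : κ → Finset V) (bcs : κ → BoundaryCondition V) {μs : κ → ProbabilityMeasure (V → ℤˣ)}
    (hμs : ∀ k, (μs k : Measure (V → ℤˣ)) = isingMeasure G (Λs k) β h (bcs k))
    {μ : ProbabilityMeasure (V → ℤˣ)} (hconv : Tendsto μs L (𝓝 μ)) : IsBoxTP2 (μ : Measure (V → ℤˣ)) :=
  isBoxTP2_of_tendsto_probabilityMeasure_spinConfig hconv
    (Eventually.of_forall fun k => by rw [hμs k]; exact isBoxTP2_isingMeasure G (Λs k) hβ h (bcs k))

/-- The same with site-dependent fields `h_k : V → ℝ` (`fieldIsingMeasure`). [this work] -/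
theorem isBoxTP2_of_tendsto_probabilityMeasure_fieldIsingMeasure {β : ℝ} (hβ : 0 ≤ β)
    (Λs : κ → Finset V) (hs : κ → V → ℝ) (bcs : κ → BoundaryCondition V)
    {μs : κ → ProbabilityMeasure (V → ℤˣ)}
    (hμs : ∀ k, (μs k : Measure (V → ℤˣ)) = fieldIsingMeasure G (Λs k) β (hs k) (bcs k))
    {μ : ProbabilityMeasure (V → ℤˣ)} (hconv : Tendsto μs L (𝓝 μ)) : IsBoxTP2 (μ : Measure (V → ℤˣ)) :=
  isBoxTP2_of_tendsto_probabilityMeasure_spinConfig hconv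
    (Eventually.of_forall fun k => by rw [hμs k]; exact isBoxTP2_fieldIsingMeasure G (Λs k) hβ (hs k) (bcs k))

variable [Infinite V]

/-- **FKG for weak limits of Ising measures**, all measurable nonnegative monotone functionals of the whole
configuration (not only local ones). [this work] -/
theorem integral_mul_integral_le_of_tendsto_isingMeasure {β : ℝ} (hβ : 0 ≤ β) (h : ℝ)
    (Λs : κ → Finset V) (bcs : κ → BoundaryCondition V) {μs : κ → ProbabilityMeasure (V → ℤˣ)}
    (hμs : ∀ k, (μs k : Measure (V → ℤˣ)) = isingMeasure G (Λs k) β h (bcs k))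
    {μ : ProbabilityMeasure (V → ℤˣ)} (hconv : Tendsto μs L (𝓝 μ)) {f g : (V → ℤˣ) → ℝ}
    (hfm : Measurable f) (hgm : Measurable g) (hf0 : ∀ σ, 0 ≤ f σ) (hg0 : ∀ σ, 0 ≤ g σ) (hf : Monotone f)
    (hg : Monotone g) :
    (∫ σ, f σ ∂(μ : Measure (V → ℤˣ))) * (∫ σ, g σ ∂(μ : Measure (V → ℤˣ))) ≤
      ∫ σ, f σ * g σ ∂(μ : Measure (V → ℤˣ)) :=
  integral_mul_integral_le_of_isBoxTP2_spinConfig (μ : Measure (V → ℤˣ))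
    (isBoxTP2_of_tendsto_probabilityMeasure_isingMeasure G hβ h Λs bcs hμs hconv) hfm hgm hf0 hg0 hf hg

/-- **Sahi positivity of every order for weak limits of Ising measures, given `C_n`.** [this work; conditional
on Sahi's conjecture `C_n`] -/
theorem msahiE_nonneg_of_tendsto_isingMeasure_of_sahiConjecture {n : ℕ} (hC : SahiConjecture n) {β : ℝ}
    (hβ : 0 ≤ β) (h : ℝ) (Λs : κ → Finset V) (bcs : κ → BoundaryCondition V)
    {μs : κ → ProbabilityMeasure (V → ℤˣ)}
    (hμs : ∀ k, (μs k : Measure (V → ℤˣ)) = isingMeasure G (Λs k) β h (bcs k))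
    {μ : ProbabilityMeasure (V → ℤˣ)} (hconv : Tendsto μs L (𝓝 μ)) (f : Fin n → (V → ℤˣ) → ℝ)
    (hfm : ∀ i, Measurable (f i)) (hf0 : ∀ i σ, 0 ≤ f i σ) (hmono : ∀ i, Monotone (f i)) :
    0 ≤ msahiE (μ : Measure (V → ℤˣ)) n f :=
  msahiE_nonneg_of_isBoxTP2_spinConfig_of_sahiConjecture hC (μ : Measure (V → ℤˣ))
    (isBoxTP2_of_tendsto_probabilityMeasure_isingMeasure G hβ h Λs bcs hμs hconv) f hfm hf0 hmono

omit [Infinite V] in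
/-- **Unconditionally: Sahi's Theorem 2 with two free local slots for weak limits of Ising measures**, every
order `n`: local nonnegative increasing `f_i`, all but at most two of them indicators of all-plus events.
[this work] -/
theorem msahiE_nonneg_plusSpins_offTwo_of_tendsto_isingMeasure {β : ℝ} (hβ : 0 ≤ β) (h : ℝ)
    (Λs : κ → Finset V) (bcs : κ → BoundaryCondition V) {μs : κ → ProbabilityMeasure (V → ℤˣ)}
    (hμs : ∀ k, (μs k : Measure (V → ℤˣ)) = isingMeasure G (Λs k) β h (bcs k))
    {μ : ProbabilityMeasure (V → ℤˣ)} (hconv : Tendsto μs L (𝓝 μ)) (J : Finset V) {n : ℕ}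
    (f : Fin n → (V → ℤˣ) → ℝ) (hdep : ∀ i, DependsOn (f i) (↑J : Set V)) (hf0 : ∀ i σ, 0 ≤ f i σ)
    (hmono : ∀ i, Monotone (f i)) (I : Finset (Fin n)) (hI : I.card ≤ 2) (A : Fin n → Finset V)
    (hcum : ∀ i, i ∉ I → f i = {σ : V → ℤˣ | ∀ v ∈ A i, σ v = 1}.indicator 1) :
    0 ≤ msahiE (μ : Measure (V → ℤˣ)) n f :=
  msahiE_nonneg_offTwo_of_isBoxTP2_local (μ : Measure (V → ℤˣ))
    (isBoxTP2_of_tendsto_probabilityMeasure_isingMeasure G hβ h Λs bcs hμs hconv) J f hdep hf0 hmono I hI A hcum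

omit [Infinite V] in
/-- **Unconditionally: positivity of every order for functions of three spins under weak limits of Ising
measures.** [this work] -/
theorem msahiE_threeSites_nonneg_of_tendsto_isingMeasure {β : ℝ} (hβ : 0 ≤ β) (h : ℝ)
    (Λs : κ → Finset V) (bcs : κ → BoundaryCondition V) {μs : κ → ProbabilityMeasure (V → ℤˣ)}
    (hμs : ∀ k, (μs k : Measure (V → ℤˣ)) = isingMeasure G (Λs k) β h (bcs k))
    {μ : ProbabilityMeasure (V → ℤˣ)} (hconv : Tendsto μs L (𝓝 μ)) {n : ℕ} (v : Fin 3 → V)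
    (g : Fin n → (Fin 3 → ℤˣ) → ℝ) (hg0 : ∀ i y, 0 ≤ g i y) (hmono : ∀ i, Monotone (g i)) :
    0 ≤ msahiE (μ : Measure (V → ℤˣ)) n fun i σ => g i fun a => σ (v a) :=
  msahiE_threeSites_nonneg_of_isBoxTP2 (μ : Measure (V → ℤˣ))
    (isBoxTP2_of_tendsto_probabilityMeasure_isingMeasure G hβ h Λs bcs hμs hconv) v g hg0 hmono

end Ising

end Summit.CriticalPhenomena.PercolationContinuityZ3.Theorems.SahiBoxTP2
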